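/-
Copyright (c) 2026 the pub-hodgecm-mathlib formalisation cell (harness21).  Prover seat hodgecm-mathlib-K2E1-p11 (g0), Track B ∕ K2-LIT,
h413 = `stmt-HodgeConjecture-24833`, line `K2_E1_TraceFormulaBeta`, campaign «EIS-WHITTAKER-3» rung J4₃ FILE B of the dealer K2E1-plan (g5) (RULING «J4₃ COUPLED» 2026-09-04T08:18:30Z).
-/
import Summits.HodgeConjecture.HodgeConjecture.Theorems.K2E1FourierJacobiSeriesConvergenceU3   -- ★ J4₃ FILE A (this seat, p858585): dilation lemma, two-index engine (decoupled currency)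
import Summits.HodgeConjecture.HodgeConjecture.Theorems.K2E1WhittakerBoundsUniformU2          -- ★ #1b: `prod_residueCard_pow_le_mul_abs_norm` (product-formula floor)
import Summits.HodgeConjecture.HodgeConjecture.Theorems.K2E1FractionalIdealAdelicSupport       -- ★ #3: the boxes `∏_v 𝔭_v^{e_v}𝒪_v ⊂ 𝔸_{K,f}` (compact; rational points)
import HarnessLib

/-!
# K2·E1 — `K2E1FourierJacobiSeriesConvergenceU3Coupled`: THE FOURIER–JACOBI LAYER CONVERGES — THE COUPLED (PER-PLACE GAUSSIAN) CONSUMER FACE OF J4₃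
# (campaign «EIS-WHITTAKER-3», rung J4₃ FILE B: the product-formula floor `|η|_w ≫ (1+‖η_∞‖)^{−[F:ℚ]}` converts `exp(−b·Σ_{w∣∞}|η|_w(1+|x₀|_w²))` into ★ FILE A's sup-norm currency)

Track B ∕ K2-LIT, crux h413 = `stmt-HodgeConjecture-24833`, route of record `HCCMUnconditional`; cell `hodgecm-mathlib`, squad K2, ENGINE E1.  Prover seat `hodgecm-mathlib-K2E1-p11` (g0);
rung J4₃ of the dealer K2E1-plan (g5), RULING «J4₃ COUPLED» 08:18:30Z (the (hJbd) hypothesis of record for J4₃ and for WIRING (γ) row J-hJbd₃).  THEOREMS ONLY (no `def`, no `instance`,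
no notation, no named-fact hypothesis, no `sorry`; default heartbeats); lane `--supports stmt-HodgeConjecture-24833 --as helper` (count-neutral).  Closes no socket.  GENERIC number fields
`F ⊂ E` (`[Algebra F E] [Algebra.IsAlgebraic F E]`; the campaign's `F = L⁺`, `E = L`); no CM input.

THE MATHEMATICS [MoeglinWaldspurger1995, I.2.10 and II.1.7; Garrett2018, §1.9–§1.10 and §2.8; NeukirchANT1999, Ch. III (1.3); WeilBNT1967, Ch. IV §2].  The archimedean Fourier–Jacobi
factor of the spherical section at the complex place `w` over the real place `v` of `F` is `A_w(x₀)^{−z}·𝓦(c_w∕A_w(x₀), z, η_v)` with `A_w = (1+½|x₀|_w²)²` (W0₃ CONVENTIONS §4 (iv),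
★ `K2E1ArchWhittakerContinuation` :144), and ★ W-ARCH-DECAY `norm_archWhittaker_le_of_re_mem_Icc` at `c := c_w∕A_w` gives the rate `(π∕√c_w)·√A_w·|η_v|`: the decay in the central
frequency `η` is COUPLED to a Gaussian in `x₀`, place by place — `‖J(z,x₀,η)‖ ≤ M·(1+‖η_∞‖)^a·(1+‖x₀,∞‖)^{a′}·exp(−b·Σ_{w∣∞ of E} |η|_w·(1+|x₀|_w²))` (`|η|_w = w(η)`, `|x₀|_w = w(x₀)`).
Since `|η|_w` is not bounded below along `η ∈ Fˣ`, the Gaussian alone gives no uniform decay in `x₀`; but `η` runs over a FRACTIONAL-IDEAL BOX (`ord_v η ≥ e_v`), so the product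
formula gives the FLOOR `|N_{F∕ℚ} η| ≥ N₀` (★ #1b `prod_residueCard_pow_le_mul_abs_norm` at `T = ∅`), whence `|η|_w ≥ min(1,N₀)·(1+‖η_∞‖)^{−[F:ℚ]}` at EVERY archimedean place, and
`e^{−β y} ≤ C_κ·max(1,β⁻¹)^κ·(1+y)^{−κ}` converts each Gaussian factor into `(1+|x₀|_w²)^{−κ}` at polynomial cost in `‖η_∞‖` — eaten by `e^{−b‖η_∞‖}` downstream (★ W4 §1).
§1 (generic `F`) **`exists_pos_le_abs_norm_of_valuation_le`** (norm floor on a box), **`exists_pos_forall_le_infinitePlace_apply`** (place floor `c₀·(1+‖η_∞‖)^{−[F:ℚ]} ≤ |η|_w`),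
**`exists_forall_exp_neg_mul_le_rpow_neg`** (`e^{−βy} ≤ C·max(1,β⁻¹)^κ·(1+y)^{−κ}`).
§2 (`F ⊂ E`) `norm_mixedEmbedding_le_sum_apply_algebraMap` (`‖η_∞‖ ≤ Σ_w |η|_w`, Mathlib `InfinitePlace.comap_surjective`), `prod_one_add_sq_rpow_neg_le` and the bridge
**`exists_decoupled_of_coupled`**: ONE `C, A` with `exp(−b·Σ_w |η|_w(1+|x₀|_w²)) ≤ C·(1+‖η_∞‖)^A·e^{−b‖η_∞‖}·(1+‖x₀,∞‖)^{−k}` for every `η ≠ 0` in the box and every `x₀ ∈ E`.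
§3 HEADS **`summable_differentiableOn_tsum_tsum_of_coupled_bounds`** — the (hJbd)-COUPLED consumer face: `W : ℂ → E → F → ℂ`, (hWhol) on the open `U`, and around every `z₀ ∈ U` ONE
coupled bound with free polynomial factors `(1+‖η_∞‖)^a(1+‖x₀,∞‖)^{a′}` and the two supports `(ι_F η)_f ∉ BOX_F(e) → W = 0` (★ #3 letters, `e_v = 0` for almost all `v`),
`(ι_E(η·x₀))_f ∉ C_E → W = 0` (`C_E` compact) ⟹ the five conclusions of ★ FILE A (summable on `E × F`, per-`x₀`, `hsumA`, locally uniform bound, holomorphy of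
`z ↦ Σ'_{x₀} Σ'_η 𝟙_{η≠0} W z x₀ η`); and **`summable_continuousOn_tsum_tsum_of_coupled_bounds`** (`𝓝[S]` twin).
HONEST LABEL: HC_CM is proved only modulo the 7 printed citations (2 remaining named inputs: hLiu418 = `stmt-HodgeConjecture-24832`, h413 = `stmt-HodgeConjecture-24833`) until rung 0
closes; this file asserts no named fact, closes no socket and crosses no ceiling by itself.
References: [MoeglinWaldspurger1995] Mœglin–Waldspurger, *Spectral Decomposition and Eisenstein Series* (1995), I.2.10, II.1.7 · [Garrett2018] Garrett, *Modern Analysis of Automorphic Forms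
by Example* 1 (2018), §1.9–§1.10, §2.8 · [NeukirchANT1999] Neukirch, *Algebraic Number Theory* (1999), Ch. III (1.3) · [WeilBNT1967] Weil, *Basic Number Theory*, Ch. IV §2 · [Bump1997] §3.7.
-/

set_option autoImplicit false
-- the mandated namespace repeats the single-problem summit's segment (`HodgeConjecture.HodgeConjecture`)
set_option linter.dupNamespace false

noncomputable section

open scoped NNReal Topology Classical
open NumberField NumberField.mixedEmbedding NumberField.InfinitePlace IsDedekindDomain Set Filter Module
open Summit.HodgeConjecture.HodgeConjecture.Cruxes.H413.K2E1WhittakerSeriesConvergenceU2 (exists_exp_neg_mul_rpow_le_rpow_neg)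
open Summit.HodgeConjecture.HodgeConjecture.Cruxes.H413.K2E1WhittakerBoundsUniformU2 (prod_residueCard_pow_le_mul_abs_norm)
open Summit.HodgeConjecture.HodgeConjecture.Cruxes.H413.K2E1FractionalIdealAdelicSupport
  (isCompact_setOf_forall_valued_le_of_eventually_eq_zero algebraMap_mem_setOf_forall_valued_le_iff snd_algebraMap)
open Summit.HodgeConjecture.HodgeConjecture.Cruxes.H413.K2E1FourierJacobiSeriesConvergenceU3

namespace Summit.HodgeConjecture.HodgeConjecture.Cruxes.H413.K2E1FourierJacobiSeriesConvergenceU3Coupled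

/-! ## §1 Generic number field `F`: the product-formula floors and `exp ≤ poly` -/

section Floors

variable (F : Type) [Field F] [NumberField F]

/-- **NORM FLOOR ON A BOX**: for exponents `e_v` vanishing for almost all `v` there is `N₀ > 0` with `N₀ ≤ |N_{F∕ℚ} η|` for every `η ≠ 0` in the box `ord_v η ≥ e_v` (all `v`)
(★ #1b `prod_residueCard_pow_le_mul_abs_norm` at `T = ∅`: `1 ≤ C_e·|N η|`). [cite: NeukirchANT1999, Ch. III (1.3)] -/
theorem exists_pos_le_abs_norm_of_valuation_le {e : HeightOneSpectrum (𝓞 F) → ℤ} (he : ∀ᶠ v in cofinite, e v = 0) :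
    ∃ N₀ : ℝ, 0 < N₀ ∧ ∀ η : F, η ≠ 0 → (∀ v : HeightOneSpectrum (𝓞 F), v.valuation F η ≤ WithZero.exp (-e v)) → N₀ ≤ |(Algebra.norm ℚ η : ℝ)| := by
  classical
  set Ce : ℝ := ∏ v ∈ he.toFinset, (v.residueCard : ℝ) ^ (-e v) with hCe
  have hq : ∀ v : HeightOneSpectrum (𝓞 F), (0 : ℝ) < v.residueCard := fun v => by exact_mod_cast (zero_lt_one.trans v.one_lt_residueCard)
  have hCe0 : 0 < Ce := Finset.prod_pos fun v _ => zpow_pos (hq v) _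
  refine ⟨Ce⁻¹, inv_pos.2 hCe0, fun η hη hbox => ?_⟩
  have h := prod_residueCard_pow_le_mul_abs_norm he hη hbox ∅ (fun _ => 0) (fun v hv => absurd hv (Finset.notMem_empty v))
  rw [Finset.prod_empty] at h
  calc Ce⁻¹ = Ce⁻¹ * 1 := (mul_one _).symm
    _ ≤ Ce⁻¹ * (Ce * |(Algebra.norm ℚ η : ℝ)|) := mul_le_mul_of_nonneg_left h (inv_nonneg.2 hCe0.le)
    _ = |(Algebra.norm ℚ η : ℝ)| := by rw [← mul_assoc, inv_mul_cancel₀ hCe0.ne', one_mul]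

/-- **PLACE FLOOR**: with `N₀` as above and `c₀ := min(1, N₀)`, every `η ≠ 0` in the box satisfies `c₀·(1+‖η_∞‖)^{−[F:ℚ]} ≤ |η|_w` at EVERY archimedean place `w`
(`|N η| = |η|_w^{m_w}·∏_{v≠w}|η|_v^{m_v} ≤ |η|_w^{m_w}·(1+‖η_∞‖)^{[F:ℚ]}`, `m_w ∈ {1,2}`). [cite: NeukirchANT1999, Ch. III (1.3)] [cite: WeilBNT1967, Ch. IV §2] -/
theorem exists_pos_forall_le_infinitePlace_apply {e : HeightOneSpectrum (𝓞 F) → ℤ} (he : ∀ᶠ v in cofinite, e v = 0) :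
    ∃ c₀ : ℝ, 0 < c₀ ∧ ∀ η : F, η ≠ 0 → (∀ v : HeightOneSpectrum (𝓞 F), v.valuation F η ≤ WithZero.exp (-e v)) →
      ∀ w : InfinitePlace F, c₀ * (1 + ‖mixedEmbedding F η‖) ^ (-(finrank ℚ F : ℝ)) ≤ w η := by
  classical
  obtain ⟨N₀, hN₀, hN⟩ := exists_pos_le_abs_norm_of_valuation_le F he
  refine ⟨min 1 N₀, lt_min one_pos hN₀, fun η hη hbox w => ?_⟩
  set R : ℝ := ‖mixedEmbedding F η‖ with hR
  have hR0 : 0 ≤ R := norm_nonneg _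
  have h1R : 1 ≤ 1 + R := by linarith
  have h1R0 : 0 < 1 + R := by linarith
  -- `N₀ ≤ |N η| = |η|_w^{m_w} · ∏_{v ≠ w} |η|_v^{m_v} ≤ |η|_w^{m_w} · (1+R)^d`
  have hprod : |(Algebra.norm ℚ η : ℝ)| = ∏ v : InfinitePlace F, v η ^ v.mult := by
    rw [InfinitePlace.prod_eq_abs_norm]; push_cast; rfl
  have hsplit : ∏ v : InfinitePlace F, v η ^ v.mult = w η ^ w.mult * ∏ v ∈ Finset.univ.erase w, v η ^ v.mult :=
    (Finset.mul_prod_erase Finset.univ (fun v : InfinitePlace F => v η ^ v.mult) (Finset.mem_univ w)).symm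
  have hrest : ∏ v ∈ Finset.univ.erase w, v η ^ v.mult ≤ (1 + R) ^ finrank ℚ F := by
    calc ∏ v ∈ Finset.univ.erase w, v η ^ v.mult ≤ ∏ v ∈ Finset.univ.erase w, (1 + R) ^ v.mult :=
          Finset.prod_le_prod (fun v _ => pow_nonneg (apply_nonneg v η) _) fun v _ =>
            pow_le_pow_left₀ (apply_nonneg v η) ((apply_le_norm_mixedEmbedding F v η).trans (by linarith)) _
      _ ≤ ∏ v : InfinitePlace F, (1 + R) ^ v.mult :=
          Finset.prod_le_prod_of_subset_of_one_le (Finset.erase_subset _ _) (fun v _ => pow_nonneg h1R0.le _) fun v _ _ => one_le_pow₀ h1R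
      _ = (1 + R) ^ finrank ℚ F := by rw [Finset.prod_pow_eq_pow_sum, InfinitePlace.sum_mult_eq]
  have hw0 : 0 ≤ w η := apply_nonneg w η
  have hpow0 : 0 < (1 + R) ^ finrank ℚ F := pow_pos h1R0 _
  have hmain : N₀ ≤ w η ^ w.mult * (1 + R) ^ finrank ℚ F := by
    calc N₀ ≤ |(Algebra.norm ℚ η : ℝ)| := hN η hη hbox
      _ = w η ^ w.mult * ∏ v ∈ Finset.univ.erase w, v η ^ v.mult := by rw [hprod, hsplit]
      _ ≤ w η ^ w.mult * (1 + R) ^ finrank ℚ F := mul_le_mul_of_nonneg_left hrest (pow_nonneg hw0 _)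
  -- `q := N₀·(1+R)^{−d} ≤ |η|_w^{m_w}`
  have hrpow : (1 + R) ^ (-(finrank ℚ F : ℝ)) = ((1 + R) ^ finrank ℚ F)⁻¹ := by
    rw [Real.rpow_neg h1R0.le, Real.rpow_natCast]
  have hq : N₀ * (1 + R) ^ (-(finrank ℚ F : ℝ)) ≤ w η ^ w.mult := by
    rw [hrpow, ← div_eq_mul_inv, div_le_iff₀ hpow0]
    exact hmain
  have hq1 : (1 + R) ^ (-(finrank ℚ F : ℝ)) ≤ 1 := by
    rw [hrpow]; exact inv_le_one_of_one_le₀ (one_le_pow₀ h1R)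
  have hq0 : 0 ≤ (1 + R) ^ (-(finrank ℚ F : ℝ)) := by rw [hrpow]; exact inv_nonneg.2 hpow0.le
  have hmin_le_q : min 1 N₀ * (1 + R) ^ (-(finrank ℚ F : ℝ)) ≤ N₀ * (1 + R) ^ (-(finrank ℚ F : ℝ)) :=
    mul_le_mul_of_nonneg_right (min_le_right _ _) hq0
  have hmin_le_one : min 1 N₀ * (1 + R) ^ (-(finrank ℚ F : ℝ)) ≤ 1 := by
    calc min 1 N₀ * (1 + R) ^ (-(finrank ℚ F : ℝ)) ≤ 1 * 1 := mul_le_mul (min_le_left _ _) hq1 hq0 zero_le_one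
      _ = 1 := mul_one _
  -- `m_w ∈ {1, 2}`
  have hm : w.mult = 1 ∨ w.mult = 2 := by
    unfold InfinitePlace.mult; split_ifs
    · exact Or.inl rfl
    · exact Or.inr rfl
  rcases hm with hm | hm
  · rw [hm, pow_one] at hq
    exact hmin_le_q.trans hq
  · rw [hm] at hq
    by_cases hw1 : 1 ≤ w η
    · exact hmin_le_one.trans hw1
    · have hsq : w η ^ 2 ≤ w η := by
        have : w η ≤ 1 := (not_le.1 hw1).le
        nlinarith
      exact hmin_le_q.trans (hq.trans hsq)

/-- **`exp ≤ poly` WITH THE RATE EXPOSED**: for `κ ≥ 0` there is `C ≥ 0` with `e^{−βy} ≤ C·max(1, β⁻¹)^κ·(1+y)^{−κ}` for all `β > 0`, `y ≥ 0` (★ W4 §1 at `b = 1`: `e^{−s} ≤ C(1+s)^{−κ}`;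
then `1 + y ≤ max(1,β⁻¹)·(1 + βy)` and ★ FILE A `one_add_rpow_neg_le_of_le_mul`). [folklore] -/
theorem exists_forall_exp_neg_mul_le_rpow_neg {κ : ℝ} (hκ : 0 ≤ κ) :
    ∃ C : ℝ, 0 ≤ C ∧ ∀ β : ℝ, 0 < β → ∀ y : ℝ, 0 ≤ y → Real.exp (-(β * y)) ≤ C * max 1 β⁻¹ ^ κ * (1 + y) ^ (-κ) := by
  obtain ⟨C, hC0, hC⟩ := exists_exp_neg_mul_rpow_le_rpow_neg one_pos 0 κ
  refine ⟨C, hC0, fun β hβ y hy => ?_⟩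
  have hs : 0 ≤ β * y := mul_nonneg hβ.le hy
  have h1 := hC (β * y) hs
  rw [one_mul, Real.rpow_zero, mul_one] at h1
  have hm : 0 < max 1 β⁻¹ := zero_lt_one.trans_le (le_max_left _ _)
  have hle : 1 + y ≤ max 1 β⁻¹ * (1 + β * y) := by
    have h2 : y = β⁻¹ * (β * y) := by rw [← mul_assoc, inv_mul_cancel₀ hβ.ne', one_mul]
    have h3 : β⁻¹ * (β * y) ≤ max 1 β⁻¹ * (β * y) := mul_le_mul_of_nonneg_right (le_max_right _ _) hs
    have h4 : (1 : ℝ) ≤ max 1 β⁻¹ * 1 := by rw [mul_one]; exact le_max_left _ _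
    calc 1 + y = 1 + β⁻¹ * (β * y) := by rw [← h2]
      _ ≤ max 1 β⁻¹ * 1 + max 1 β⁻¹ * (β * y) := add_le_add h4 h3
      _ = max 1 β⁻¹ * (1 + β * y) := by ring
  have h5 := one_add_rpow_neg_le_of_le_mul hy hs hm hκ hle
  calc Real.exp (-(β * y)) ≤ C * (1 + β * y) ^ (-κ) := h1
    _ ≤ C * (max 1 β⁻¹ ^ κ * (1 + y) ^ (-κ)) := mul_le_mul_of_nonneg_left h5 hC0
    _ = C * max 1 β⁻¹ ^ κ * (1 + y) ^ (-κ) := (mul_assoc _ _ _).symm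

end Floors

/-! ## §2 `F ⊂ E`: the COUPLED per-place Gaussian is dominated by the DECOUPLED sup-norm weight -/

section Bridge

variable (F E : Type) [Field F] [NumberField F] [Field E] [NumberField E] [Algebra F E] [Algebra.IsAlgebraic F E]

/-- `‖η_∞‖_F ≤ Σ_{w∣∞ of E} |η|_w`: the sup over the places of `F` is attained at some `v`, and `v` extends to a place `w` of `E` (Mathlib `InfinitePlace.comap_surjective`).
[cite: WeilBNT1967, Ch. IV §2] -/
theorem norm_mixedEmbedding_le_sum_apply_algebraMap (η : F) : ‖mixedEmbedding F η‖ ≤ ∑ w : InfinitePlace E, w (algebraMap F E η) := by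
  obtain ⟨v, hv⟩ := exists_apply_eq_norm_mixedEmbedding F η
  obtain ⟨w, hw⟩ := comap_surjective (k := F) (K := E) v
  rw [← hv, ← hw, comap_apply]
  exact Finset.single_le_sum (fun w _ => apply_nonneg w (algebraMap F E η)) (Finset.mem_univ w)

omit [NumberField F] [Algebra F E] [Algebra.IsAlgebraic F E] in
/-- `∏_{w∣∞} (1+|x₀|_w²)^{−κ} ≤ 2^κ·(1+‖x₀,∞‖)^{−2κ}`: keep only the factor at a place where the sup norm is attained (the others are `≤ 1`), then `(1+X)² ≤ 2(1+X²)`. [folklore] -/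
theorem prod_one_add_sq_rpow_neg_le (x₀ : E) {κ : ℝ} (hκ : 0 ≤ κ) :
    ∏ w : InfinitePlace E, (1 + w x₀ ^ 2) ^ (-κ) ≤ (2 : ℝ) ^ κ * (1 + ‖mixedEmbedding E x₀‖) ^ (-(2 * κ)) := by
  obtain ⟨w₀, hw₀⟩ := exists_apply_eq_norm_mixedEmbedding E x₀
  set X : ℝ := ‖mixedEmbedding E x₀‖ with hX
  have hX0 : 0 ≤ X := norm_nonneg _
  have hf0 : ∀ w : InfinitePlace E, 0 ≤ (1 + w x₀ ^ 2) ^ (-κ) := fun w => Real.rpow_nonneg (by positivity) _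
  have hf1 : ∀ w : InfinitePlace E, (1 + w x₀ ^ 2) ^ (-κ) ≤ 1 := fun w =>
    Real.rpow_le_one_of_one_le_of_nonpos (by nlinarith [sq_nonneg (w x₀)]) (by linarith)
  have h1 : ∏ w : InfinitePlace E, (1 + w x₀ ^ 2) ^ (-κ) ≤ (1 + w₀ x₀ ^ 2) ^ (-κ) := by
    rw [← Finset.mul_prod_erase Finset.univ (fun w : InfinitePlace E => (1 + w x₀ ^ 2) ^ (-κ)) (Finset.mem_univ w₀)]
    exact mul_le_of_le_one_right (hf0 w₀) (Finset.prod_le_one (fun w _ => hf0 w) fun w _ => hf1 w)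
  rw [hw₀] at h1
  -- `(1+X²)^{−κ} ≤ 2^κ·((1+X)²)^{−κ}` from `1 + (2X + X²) = (1+X)² ≤ 2·(1 + X²)`
  have h2 : (1 + X ^ 2) ^ (-κ) ≤ (2 : ℝ) ^ κ * (1 + (2 * X + X ^ 2)) ^ (-κ) :=
    one_add_rpow_neg_le_of_le_mul (by positivity) (by positivity) two_pos hκ (by nlinarith [sq_nonneg (X - 1)])
  have h3 : (1 + (2 * X + X ^ 2)) ^ (-κ) = (1 + X) ^ (-(2 * κ)) := by
    rw [show 1 + (2 * X + X ^ 2) = (1 + X) ^ 2 by ring, ← Real.rpow_natCast, ← Real.rpow_mul (by linarith)]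
    congr 1
    push_cast
    ring
  calc ∏ w : InfinitePlace E, (1 + w x₀ ^ 2) ^ (-κ) ≤ (1 + X ^ 2) ^ (-κ) := h1
    _ ≤ (2 : ℝ) ^ κ * (1 + (2 * X + X ^ 2)) ^ (-κ) := h2
    _ = (2 : ℝ) ^ κ * (1 + X) ^ (-(2 * κ)) := by rw [h3]

/-- **COUPLED ⟹ DECOUPLED.**  For a box `e` (`e_v = 0` for almost all `v`), a rate `b > 0` and a target exponent `k`, there are ONE `C ≥ 0` and ONE `A` such that for every `η ∈ Fˣ` in the box
(`ord_v η ≥ e_v` for all `v`) and every `x₀ ∈ E`: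
`exp(−b·Σ_{w∣∞ of E} |η|_w·(1+|x₀|_w²)) ≤ C·(1+‖η_∞‖)^A·e^{−b‖η_∞‖}·(1+‖x₀,∞‖)^{−k}`  (split `Σ = Σ|η|_w + Σ|η|_w|x₀|_w²`; `Σ_w|η|_w ≥ ‖η_∞‖`; each Gaussian factor by §1's
`exp ≤ poly` at `β = b|η|_w ≥ b c₀(1+‖η_∞‖)^{−[F:ℚ]}`, `κ = k∕2`; the product over the places by `prod_one_add_sq_rpow_neg_le`). [cite: Garrett2018, §1.9–§1.10] [cite: NeukirchANT1999, Ch. III (1.3)] -/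
theorem exists_decoupled_of_coupled {e : HeightOneSpectrum (𝓞 F) → ℤ} (he : ∀ᶠ v in cofinite, e v = 0) {b : ℝ} (hb : 0 < b) (k : ℕ) :
    ∃ C A : ℝ, 0 ≤ C ∧ ∀ η : F, η ≠ 0 → (∀ v : HeightOneSpectrum (𝓞 F), v.valuation F η ≤ WithZero.exp (-e v)) → ∀ x₀ : E,
      Real.exp (-(b * ∑ w : InfinitePlace E, w (algebraMap F E η) * (1 + w x₀ ^ 2))) ≤
        C * (1 + ‖mixedEmbedding F η‖) ^ A * Real.exp (-(b * ‖mixedEmbedding F η‖)) * (1 + ‖mixedEmbedding E x₀‖) ^ (-(k : ℝ)) := by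
  set κ : ℝ := (k : ℝ) / 2 with hκ
  have hκ0 : 0 ≤ κ := by positivity
  obtain ⟨C₁, hC₁0, hC₁⟩ := exists_forall_exp_neg_mul_le_rpow_neg (κ := κ) hκ0
  obtain ⟨c₀, hc₀, hfloor⟩ := exists_pos_forall_le_infinitePlace_apply F he
  set d : ℕ := finrank ℚ F with hd
  set n : ℕ := Fintype.card (InfinitePlace E) with hn
  set m₁ : ℝ := max 1 (b⁻¹ * c₀⁻¹) with hm₁
  have hm₁1 : 1 ≤ m₁ := le_max_left _ _
  have hm₁0 : 0 ≤ m₁ := zero_le_one.trans hm₁1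
  refine ⟨(C₁ * m₁ ^ κ) ^ n * (2 : ℝ) ^ κ, (d : ℝ) * κ * n, by positivity, fun η hη hbox x₀ => ?_⟩
  set R : ℝ := ‖mixedEmbedding F η‖ with hR
  set X : ℝ := ‖mixedEmbedding E x₀‖ with hX
  have hR0 : 0 ≤ R := norm_nonneg _
  have h1R : 1 ≤ 1 + R := by linarith
  have h1R0 : 0 < 1 + R := by linarith
  -- (1) split the exponential
  have hsplit : Real.exp (-(b * ∑ w : InfinitePlace E, w (algebraMap F E η) * (1 + w x₀ ^ 2))) =
      Real.exp (-(b * ∑ w : InfinitePlace E, w (algebraMap F E η))) * ∏ w : InfinitePlace E, Real.exp (-(b * w (algebraMap F E η) * w x₀ ^ 2)) := by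
    rw [← Real.exp_sum, ← Real.exp_add]
    congr 1
    simp only [Finset.mul_sum, ← Finset.sum_neg_distrib, ← Finset.sum_add_distrib]
    exact Finset.sum_congr rfl fun w _ => by ring
  -- (2) the pure `η`-part: `Σ_w |η|_w ≥ ‖η_∞‖`
  have hηR : Real.exp (-(b * ∑ w : InfinitePlace E, w (algebraMap F E η))) ≤ Real.exp (-(b * R)) := by
    rw [Real.exp_le_exp, neg_le_neg_iff]
    exact mul_le_mul_of_nonneg_left (norm_mixedEmbedding_le_sum_apply_algebraMap F E η) hb.le
  -- (3) each Gaussian factor: `exp(−b|η|_w·|x₀|_w²) ≤ K₀·(1+|x₀|_w²)^{−κ}`, `K₀ := C₁·(m₁·(1+R)^d)^κ`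
  set K₀ : ℝ := C₁ * (m₁ * (1 + R) ^ (d : ℝ)) ^ κ with hK₀
  have hK₀0 : 0 ≤ K₀ := by positivity
  have hfac : ∀ w : InfinitePlace E, Real.exp (-(b * w (algebraMap F E η) * w x₀ ^ 2)) ≤ K₀ * (1 + w x₀ ^ 2) ^ (-κ) := by
    intro w
    have hwpos : 0 < w (algebraMap F E η) := InfinitePlace.pos_iff.2 ((map_ne_zero (algebraMap F E)).2 hη)
    have hβ : 0 < b * w (algebraMap F E η) := mul_pos hb hwpos
    have h1 := hC₁ (b * w (algebraMap F E η)) hβ (w x₀ ^ 2) (sq_nonneg _)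
    -- the floor at the place `w|_F`
    have hfl : c₀ * (1 + R) ^ (-(d : ℝ)) ≤ w (algebraMap F E η) := by
      have h := hfloor η hη hbox (w.comap (algebraMap F E))
      rwa [comap_apply] at h
    have hfl0 : 0 < c₀ * (1 + R) ^ (-(d : ℝ)) := mul_pos hc₀ (Real.rpow_pos_of_pos h1R0 _)
    have hinv : (b * w (algebraMap F E η))⁻¹ ≤ m₁ * (1 + R) ^ (d : ℝ) := by
      calc (b * w (algebraMap F E η))⁻¹ = b⁻¹ * (w (algebraMap F E η))⁻¹ := mul_inv _ _
        _ ≤ b⁻¹ * (c₀ * (1 + R) ^ (-(d : ℝ)))⁻¹ := mul_le_mul_of_nonneg_left ((inv_le_inv₀ hwpos hfl0).2 hfl) (inv_nonneg.2 hb.le)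
        _ = b⁻¹ * c₀⁻¹ * (1 + R) ^ (d : ℝ) := by rw [mul_inv, Real.rpow_neg h1R0.le, inv_inv, mul_assoc]
        _ ≤ m₁ * (1 + R) ^ (d : ℝ) := mul_le_mul_of_nonneg_right (le_max_right _ _) (Real.rpow_nonneg h1R0.le _)
    have hone : (1 : ℝ) ≤ m₁ * (1 + R) ^ (d : ℝ) := by
      calc (1 : ℝ) = 1 * 1 := (mul_one _).symm
        _ ≤ m₁ * (1 + R) ^ (d : ℝ) := mul_le_mul hm₁1 (Real.one_le_rpow h1R (Nat.cast_nonneg d)) zero_le_one hm₁0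
    have hmax : max 1 (b * w (algebraMap F E η))⁻¹ ≤ m₁ * (1 + R) ^ (d : ℝ) := max_le hone hinv
    have hmaxκ : max 1 (b * w (algebraMap F E η))⁻¹ ^ κ ≤ (m₁ * (1 + R) ^ (d : ℝ)) ^ κ :=
      Real.rpow_le_rpow (zero_le_one.trans (le_max_left _ _)) hmax hκ0
    have hy0 : 0 ≤ (1 + w x₀ ^ 2) ^ (-κ) := Real.rpow_nonneg (by positivity) _
    calc Real.exp (-(b * w (algebraMap F E η) * w x₀ ^ 2)) ≤ C₁ * max 1 (b * w (algebraMap F E η))⁻¹ ^ κ * (1 + w x₀ ^ 2) ^ (-κ) := h1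
      _ ≤ C₁ * (m₁ * (1 + R) ^ (d : ℝ)) ^ κ * (1 + w x₀ ^ 2) ^ (-κ) := by gcongr
  -- (4) the product over the places
  have hprod : ∏ w : InfinitePlace E, Real.exp (-(b * w (algebraMap F E η) * w x₀ ^ 2)) ≤ K₀ ^ n * ((2 : ℝ) ^ κ * (1 + X) ^ (-(k : ℝ))) := by
    have hk2 : -(2 * κ) = -(k : ℝ) := by rw [hκ]; ring
    calc ∏ w : InfinitePlace E, Real.exp (-(b * w (algebraMap F E η) * w x₀ ^ 2)) ≤ ∏ w : InfinitePlace E, (K₀ * (1 + w x₀ ^ 2) ^ (-κ)) :=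
          Finset.prod_le_prod (fun w _ => (Real.exp_pos _).le) fun w _ => hfac w
      _ = K₀ ^ n * ∏ w : InfinitePlace E, (1 + w x₀ ^ 2) ^ (-κ) := by rw [Finset.prod_mul_distrib, Finset.prod_const, Finset.card_univ]
      _ ≤ K₀ ^ n * ((2 : ℝ) ^ κ * (1 + X) ^ (-(2 * κ))) := mul_le_mul_of_nonneg_left (prod_one_add_sq_rpow_neg_le E x₀ hκ0) (pow_nonneg hK₀0 _)
      _ = K₀ ^ n * ((2 : ℝ) ^ κ * (1 + X) ^ (-(k : ℝ))) := by rw [hk2]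
  -- (5) `K₀^n = (C₁ m₁^κ)^n · (1+R)^{dκn}`
  have hK₀n : K₀ ^ n = (C₁ * m₁ ^ κ) ^ n * (1 + R) ^ ((d : ℝ) * κ * n) := by
    rw [hK₀, Real.mul_rpow hm₁0 (Real.rpow_nonneg h1R0.le _), ← Real.rpow_mul h1R0.le, ← mul_assoc, mul_pow, ← Real.rpow_natCast ((1 + R) ^ ((d : ℝ) * κ)),
      ← Real.rpow_mul h1R0.le]
  have hexp0 : 0 ≤ Real.exp (-(b * ∑ w : InfinitePlace E, w (algebraMap F E η))) := (Real.exp_pos _).le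
  have hP0 : 0 ≤ ∏ w : InfinitePlace E, Real.exp (-(b * w (algebraMap F E η) * w x₀ ^ 2)) := Finset.prod_nonneg fun w _ => (Real.exp_pos _).le
  calc Real.exp (-(b * ∑ w : InfinitePlace E, w (algebraMap F E η) * (1 + w x₀ ^ 2)))
      = Real.exp (-(b * ∑ w : InfinitePlace E, w (algebraMap F E η))) * ∏ w : InfinitePlace E, Real.exp (-(b * w (algebraMap F E η) * w x₀ ^ 2)) := hsplit
    _ ≤ Real.exp (-(b * R)) * (K₀ ^ n * ((2 : ℝ) ^ κ * (1 + X) ^ (-(k : ℝ)))) := mul_le_mul hηR hprod hP0 (Real.exp_pos _).le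
    _ = (C₁ * m₁ ^ κ) ^ n * (2 : ℝ) ^ κ * (1 + R) ^ ((d : ℝ) * κ * n) * Real.exp (-(b * R)) * (1 + X) ^ (-(k : ℝ)) := by rw [hK₀n]; ring

end Bridge

/-! ## §3 The heads: the (hJbd)-COUPLED consumer face -/

section Coupled

variable (F E : Type) [Field F] [NumberField F] [Field E] [NumberField E] [Algebra F E] [Algebra.IsAlgebraic F E]

/-- Pure-real assembly step: `w ≤ M(1+R)^a(1+X)^{a′}·T` and `T ≤ C(1+R)^A e^{−bR}(1+X)^{−(c+k₀)}` with `a′ ≤ c` give `w ≤ (MC)·e^{−bR}(1+R)^{a+A}(1+X)^{−k₀}`. [folklore] -/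
theorem le_decoupled_of_le_coupled {w M C A a a' b R X T c k₀ : ℝ} (hM : 0 ≤ M) (hC : 0 ≤ C) (hR : 0 ≤ R) (hX : 0 ≤ X) (ha'c : a' ≤ c)
    (hw : w ≤ M * (1 + R) ^ a * (1 + X) ^ a' * T) (hT : T ≤ C * (1 + R) ^ A * Real.exp (-(b * R)) * (1 + X) ^ (-(c + k₀))) :
    w ≤ M * C * Real.exp (-(b * R)) * (1 + R) ^ (a + A) * (1 + X) ^ (-k₀) := by
  have h1R : 0 < 1 + R := by linarith
  have h1X : 0 < 1 + X := by linarith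
  have hXpow : (1 + X) ^ a' * (1 + X) ^ (-(c + k₀)) ≤ (1 + X) ^ (-k₀) := by
    have h1 : (1 + X) ^ a' ≤ (1 + X) ^ c := Real.rpow_le_rpow_of_exponent_le (by linarith) ha'c
    have h2 : (1 + X) ^ c * (1 + X) ^ (-(c + k₀)) = (1 + X) ^ (-k₀) := by
      rw [← Real.rpow_add h1X]
      congr 1
      ring
    rw [← h2]
    exact mul_le_mul_of_nonneg_right h1 (Real.rpow_nonneg h1X.le _)
  have hRa : 0 ≤ (1 + R) ^ a := Real.rpow_nonneg h1R.le _
  have hRA : 0 ≤ (1 + R) ^ A := Real.rpow_nonneg h1R.le _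
  have hXa : 0 ≤ (1 + X) ^ a' := Real.rpow_nonneg h1X.le _
  have hpre : 0 ≤ M * (1 + R) ^ a * (1 + X) ^ a' := mul_nonneg (mul_nonneg hM hRa) hXa
  have hmid : 0 ≤ M * C * Real.exp (-(b * R)) * ((1 + R) ^ a * (1 + R) ^ A) :=
    mul_nonneg (mul_nonneg (mul_nonneg hM hC) (Real.exp_pos _).le) (mul_nonneg hRa hRA)
  calc w ≤ M * (1 + R) ^ a * (1 + X) ^ a' * T := hw
    _ ≤ M * (1 + R) ^ a * (1 + X) ^ a' * (C * (1 + R) ^ A * Real.exp (-(b * R)) * (1 + X) ^ (-(c + k₀))) := mul_le_mul_of_nonneg_left hT hpre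
    _ = M * C * Real.exp (-(b * R)) * ((1 + R) ^ a * (1 + R) ^ A) * ((1 + X) ^ a' * (1 + X) ^ (-(c + k₀))) := by ring
    _ ≤ M * C * Real.exp (-(b * R)) * ((1 + R) ^ a * (1 + R) ^ A) * (1 + X) ^ (-k₀) := mul_le_mul_of_nonneg_left hXpow hmid
    _ = M * C * Real.exp (-(b * R)) * (1 + R) ^ (a + A) * (1 + X) ^ (-k₀) := by rw [← Real.rpow_add h1R]

/-- **The coupled bound on a parameter set `V` implies a decoupled bound on `V`** (with `k₀ = [E:ℚ] + 1`, the same supports, and `a + A`, `M·C` as new constants).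
[cite: Garrett2018, §1.9–§1.10] -/
theorem exists_decoupled_bound_of_coupled_bound {V : Set ℂ} {W : ℂ → E → F → ℂ} {M b a a' : ℝ} (hM0 : 0 ≤ M) (hb : 0 < b)
    {e : HeightOneSpectrum (𝓞 F) → ℤ} (he : ∀ᶠ v in cofinite, e v = 0) {CE : Set (FiniteAdeleRing (𝓞 E) E)}
    (hbd : ∀ z ∈ V, ∀ (x₀ : E) (η : F), η ≠ 0 →
        ‖W z x₀ η‖ ≤ M * (1 + ‖mixedEmbedding F η‖) ^ a * (1 + ‖mixedEmbedding E x₀‖) ^ a' *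
            Real.exp (-(b * ∑ w : InfinitePlace E, w (algebraMap F E η) * (1 + w x₀ ^ 2))) ∧
        ((algebraMap F (AdeleRing (𝓞 F) F) η).2 ∉ {x : FiniteAdeleRing (𝓞 F) F | ∀ v, Valued.v (x v) ≤ WithZero.exp (-(e v))} → W z x₀ η = 0) ∧
        ((algebraMap E (AdeleRing (𝓞 E) E) (algebraMap F E η * x₀)).2 ∉ CE → W z x₀ η = 0)) :
    ∃ (M' a'' : ℝ), 0 ≤ M' ∧ ∀ z ∈ V, ∀ (x₀ : E) (η : F), η ≠ 0 →
        ‖W z x₀ η‖ ≤ M' * Real.exp (-(b * ‖mixedEmbedding F η‖)) * (1 + ‖mixedEmbedding F η‖) ^ a'' * (1 + ‖mixedEmbedding E x₀‖) ^ (-((finrank ℚ E + 1 : ℕ) : ℝ)) ∧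
        ((algebraMap F (AdeleRing (𝓞 F) F) η).2 ∉ {x : FiniteAdeleRing (𝓞 F) F | ∀ v, Valued.v (x v) ≤ WithZero.exp (-(e v))} → W z x₀ η = 0) ∧
        ((algebraMap E (AdeleRing (𝓞 E) E) (algebraMap F E η * x₀)).2 ∉ CE → W z x₀ η = 0) := by
  obtain ⟨C, A, hC0, hC⟩ := exists_decoupled_of_coupled F E he hb (⌈max a' 0⌉₊ + (finrank ℚ E + 1))
  refine ⟨M * C, a + A, mul_nonneg hM0 hC0, fun z hz x₀ η hη => ?_⟩
  obtain ⟨hle, hsF, hsE⟩ := hbd z hz x₀ η hη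
  refine ⟨?_, hsF, hsE⟩
  by_cases hbox : (algebraMap F (AdeleRing (𝓞 F) F) η).2 ∈ {x : FiniteAdeleRing (𝓞 F) F | ∀ v, Valued.v (x v) ≤ WithZero.exp (-(e v))}
  · rw [snd_algebraMap] at hbox
    have hval : ∀ v : HeightOneSpectrum (𝓞 F), v.valuation F η ≤ WithZero.exp (-e v) := (algebraMap_mem_setOf_forall_valued_le_iff F e η).1 hbox
    have hbr := hC η hη hval x₀
    have ha'c : a' ≤ (⌈max a' 0⌉₊ : ℝ) := (le_max_left a' 0).trans (Nat.le_ceil _)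
    have hcast : -(((⌈max a' 0⌉₊ + (finrank ℚ E + 1) : ℕ) : ℝ)) = -((⌈max a' 0⌉₊ : ℝ) + ((finrank ℚ E + 1 : ℕ) : ℝ)) := by push_cast; ring
    rw [hcast] at hbr
    exact le_decoupled_of_le_coupled hM0 hC0 (norm_nonneg _) (norm_nonneg _) ha'c hle hbr
  · rw [hsF hbox, norm_zero]
    positivity

/-- **J4₃ ENGINE, (hJbd)-COUPLED CURRENCY (the consumer face of RULING «J4₃ COUPLED»).**  Let `U ⊆ ℂ` be open and `W : ℂ → E → F → ℂ` (the Fourier–Jacobi coefficient of ★ W1₃ as a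
function of `(z, x₀, η)`) with (hWhol) `z ↦ W z x₀ η` holomorphic on `U` for every `x₀ ∈ E`, `η ∈ Fˣ`, and (hWbd) around every `z₀ ∈ U` a neighbourhood `V` with ONE bound
`‖W z x₀ η‖ ≤ M·(1+‖η_∞‖)^a·(1+‖x₀,∞‖)^{a′}·exp(−b·Σ_{w∣∞ of E} |η|_w·(1 + |x₀|_w²))` (`M ≥ 0`, `b > 0`, `a, a′ ∈ ℝ`; `|η|_w = w(η)`, `|x₀|_w = w(x₀)`, sup norms `‖mixedEmbedding · ‖`) and
the TWO supports: `W z x₀ η = 0` unless `(ι_F η)_f` lies in the box `∏_v 𝔭_v^{e_v}𝒪_v` (`e_v = 0` for almost all `v`) and unless `(ι_E(η·x₀))_f ∈ C_E` (compact).  Then: (i) for every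
`z ∈ U` the family `(x₀, η) ↦ 𝟙_{η≠0}‖W z x₀ η‖` is summable on `E × F`; (i′) `η ↦ 𝟙_{η≠0}‖W z x₀ η‖` is summable for every `x₀`; (i″) `x₀ ↦ Σ'_η 𝟙_{η≠0}‖W z x₀ η‖` is summable
(★ W1₃'s `hsumA`); (ii) around every `z₀ ∈ U` ONE `C` with `Σ'_{x₀} Σ'_η 𝟙_{η≠0}‖W z x₀ η‖ ≤ C`; (iii) `z ↦ Σ'_{x₀} Σ'_η 𝟙_{η≠0}·W z x₀ η` is holomorphic on `U`.
[cite: MoeglinWaldspurger1995, I.2.10 and II.1.7] [cite: Garrett2018, §1.9–§1.10 and §2.8] [cite: GelbartPS1984, §2 (2.2.1)–(2.2.2)] -/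
theorem summable_differentiableOn_tsum_tsum_of_coupled_bounds {U : Set ℂ} (hU : IsOpen U) {W : ℂ → E → F → ℂ}
    (hWhol : ∀ (x₀ : E) (η : F), η ≠ 0 → DifferentiableOn ℂ (fun z => W z x₀ η) U)
    (hWbd : ∀ z₀ ∈ U, ∃ V ∈ 𝓝 z₀, ∃ (M b a a' : ℝ) (e : HeightOneSpectrum (𝓞 F) → ℤ) (CE : Set (FiniteAdeleRing (𝓞 E) E)),
      0 ≤ M ∧ 0 < b ∧ (∀ᶠ v in cofinite, e v = 0) ∧ IsCompact CE ∧
      ∀ z ∈ V, ∀ (x₀ : E) (η : F), η ≠ 0 →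
        ‖W z x₀ η‖ ≤ M * (1 + ‖mixedEmbedding F η‖) ^ a * (1 + ‖mixedEmbedding E x₀‖) ^ a' *
            Real.exp (-(b * ∑ w : InfinitePlace E, w (algebraMap F E η) * (1 + w x₀ ^ 2))) ∧
        ((algebraMap F (AdeleRing (𝓞 F) F) η).2 ∉ {x : FiniteAdeleRing (𝓞 F) F | ∀ v, Valued.v (x v) ≤ WithZero.exp (-(e v))} → W z x₀ η = 0) ∧
        ((algebraMap E (AdeleRing (𝓞 E) E) (algebraMap F E η * x₀)).2 ∉ CE → W z x₀ η = 0)) :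
    (∀ z ∈ U, Summable fun p : E × F => ({0}ᶜ : Set F).indicator (fun η => ‖W z p.1 η‖) p.2) ∧
    (∀ z ∈ U, ∀ x₀ : E, Summable fun η : F => ({0}ᶜ : Set F).indicator (fun η => ‖W z x₀ η‖) η) ∧
    (∀ z ∈ U, Summable fun x₀ : E => ∑' η : F, ({0}ᶜ : Set F).indicator (fun η => ‖W z x₀ η‖) η) ∧
    (∀ z₀ ∈ U, ∃ V ∈ 𝓝 z₀, ∃ C : ℝ, ∀ z ∈ V, ∑' x₀ : E, ∑' η : F, ({0}ᶜ : Set F).indicator (fun η => ‖W z x₀ η‖) η ≤ C) ∧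
    DifferentiableOn ℂ (fun z => ∑' x₀ : E, ∑' η : F, ({0}ᶜ : Set F).indicator (W z x₀) η) U := by
  refine summable_differentiableOn_tsum_tsum_of_decoupled_bounds F E hU hWhol fun z₀ hz₀ => ?_
  obtain ⟨V, hV, M, b, a, a', e, CE, hM0, hb, he, hCE, hbd⟩ := hWbd z₀ hz₀
  obtain ⟨M', a'', hM'0, hbd'⟩ := exists_decoupled_bound_of_coupled_bound F E hM0 hb he hbd
  exact ⟨V, hV, M', b, a'', finrank ℚ E + 1, _, CE, hM'0, hb, Nat.lt_succ_self _, isCompact_setOf_forall_valued_le_of_eventually_eq_zero F he, hCE, hbd'⟩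

/-- **J4₃ ENGINE, (hJbd)-COUPLED CURRENCY, CONTINUITY UP TO THE EDGE**: on an arbitrary `S ⊆ ℂ`, every `z ↦ W z x₀ η` (`η ≠ 0`) continuous on `S` and around every `z₀ ∈ S` a
neighbourhood WITHIN `S` with ONE coupled bound and the two supports ⟹ summability on `E × F` for every `z ∈ S` and continuity of `z ↦ Σ'_{x₀} Σ'_η 𝟙_{η≠0} W z x₀ η` on `S`.
[cite: Garrett2018, §1.9–§1.10] [cite: Bump1997, §3.7] -/
theorem summable_continuousOn_tsum_tsum_of_coupled_bounds {S : Set ℂ} {W : ℂ → E → F → ℂ}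
    (hWcont : ∀ (x₀ : E) (η : F), η ≠ 0 → ContinuousOn (fun z => W z x₀ η) S)
    (hWbd : ∀ z₀ ∈ S, ∃ V ∈ 𝓝[S] z₀, ∃ (M b a a' : ℝ) (e : HeightOneSpectrum (𝓞 F) → ℤ) (CE : Set (FiniteAdeleRing (𝓞 E) E)),
      0 ≤ M ∧ 0 < b ∧ (∀ᶠ v in cofinite, e v = 0) ∧ IsCompact CE ∧
      ∀ z ∈ V, ∀ (x₀ : E) (η : F), η ≠ 0 →
        ‖W z x₀ η‖ ≤ M * (1 + ‖mixedEmbedding F η‖) ^ a * (1 + ‖mixedEmbedding E x₀‖) ^ a' *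
            Real.exp (-(b * ∑ w : InfinitePlace E, w (algebraMap F E η) * (1 + w x₀ ^ 2))) ∧
        ((algebraMap F (AdeleRing (𝓞 F) F) η).2 ∉ {x : FiniteAdeleRing (𝓞 F) F | ∀ v, Valued.v (x v) ≤ WithZero.exp (-(e v))} → W z x₀ η = 0) ∧
        ((algebraMap E (AdeleRing (𝓞 E) E) (algebraMap F E η * x₀)).2 ∉ CE → W z x₀ η = 0)) :
    (∀ z ∈ S, Summable fun p : E × F => ({0}ᶜ : Set F).indicator (fun η => ‖W z p.1 η‖) p.2) ∧
    ContinuousOn (fun z => ∑' x₀ : E, ∑' η : F, ({0}ᶜ : Set F).indicator (W z x₀) η) S := by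
  refine summable_continuousOn_tsum_tsum_of_decoupled_bounds F E hWcont fun z₀ hz₀ => ?_
  obtain ⟨V, hV, M, b, a, a', e, CE, hM0, hb, he, hCE, hbd⟩ := hWbd z₀ hz₀
  obtain ⟨M', a'', hM'0, hbd'⟩ := exists_decoupled_bound_of_coupled_bound F E hM0 hb he hbd
  exact ⟨V, hV, M', b, a'', finrank ℚ E + 1, _, CE, hM'0, hb, Nat.lt_succ_self _, isCompact_setOf_forall_valued_le_of_eventually_eq_zero F he, hCE, hbd'⟩

end Coupled

end Summit.HodgeConjecture.HodgeConjecture.Cruxes.H413.K2E1FourierJacobiSeriesConvergenceU3Coupled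

end
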